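import Summits.Schanuel.Schanuel.Theorems.DiophantineDichotomyApproximationPropertyCycleAPIAt3Defs
import Summits.Schanuel.Schanuel.Theorems.DiophantineDichotomyApproximationPropertyCycleAPThreeDichotomy
import Summits.Schanuel.Schanuel.Theorems.DiophantineDichotomyApproximationPropertySmallPrimeCurveThree
import Summits.Schanuel.Schanuel.Theorems.DiophantineDichotomyApproximationPropertySmallPrimeHypersurface
import Summits.Schanuel.Schanuel.Theorems.DiophantineDichotomyApproximationPropertyCurveHilbertLB
import HarnessLib

/-!
# Stub plan `CycleAPIAt3`, P1: the clause-free `t = 3` descent with its construction data (crux `ApproximationProperty`, stmt-Schanuel-6117)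

Crux `stmt-Schanuel-6117` (`Summit.Schanuel.Schanuel.Theses.DiophantineDichotomy.ApproximationProperty`),
line `orbit-interpolation-determinant`, registered stub `stub_cycleAP3Data : CycleAP3Data` (stub plan
`Cruxes/ApproximationProperty/STUB-PLAN-CycleAPIAt3.md`, P1; vocabulary
`…CycleAPIAt3Defs.lean`: `CycleAP3Datum`, `CycleAP3Data`).

This is the construction of the landed clause-free cut 3 (`CycleAP3Dichotomy.cut3_exposed`,
`CycleAP3PrimeOfCurve.cut3`) run once more, unconditionally (the small prime space curve is
`smallPrimeCurve3_of small_prime_hypersurface`, the Hilbert lower bound is `curveHilbert_lowerBound`),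
with ALL of its data KEPT in the order of `CycleAP3Datum`: for every `ω ∈ ℂ³` a constant
`c = 5000(c₂ + 1)(c_B + 1)` such that for `c ≤ Δ ≤ Y` we get the surface `Q` (`(Q)` prime,
`deg a ≤ Δ`), the second cut `P ∉ (Q)` (`deg b ≤ 2Δ`), the prime curve `𝔮 ∋ Q, P` of rank `2` with
`deg 𝔮 ≤ 2Δ²`, `h(𝔮) ≤ cΔY`, `|𝔮(1:ω)| ≤ exp(−(Δ/c)(Δ h(𝔮) + Y deg 𝔮))` (the curve's bounds at the
smaller constant `c₂ ≤ c`, weakened), the third form `T ∉ 𝔮` of degree `τ = a + b + ⌊Δ⌋ ≤ 5Δ`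
(box principle modulo `𝔮`, `boxPrinciple_modIdeal`, with the adaptive height of the template) and the
prime orbit `𝔭 ⊇ 𝔮 + (T)` of `small_prime_of_cut` (`m = 3`, `r = 2`, weights `(Δ, Y)`) with the
Bézout bound `deg 𝔭 ≤ deg 𝔮 · τ` and the three `CycleAPIAt 3` budgets `deg 𝔭 ≤ (cΔ)³`,
`h(𝔭) ≤ cYΔ²`, `|𝔭(1:ω)| ≤ exp(−(Δ h(𝔭) + Y deg 𝔭)/c)`.

Proofs only (no definitions, no named facts); bookkeeping over landed theorems. Sources:
Nesterenko–Philippon (eds.), LNM 1752 (2001), Ch. 3 §4 (Prop. 4.7, 4.11, 4.13, pp. 39–41), §5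
(p. 42), Ch. 4 §4 p. 61 (AP1 with `d' = 0`, `n = 3`); Philippon, J. Number Theory 81 (2000).
-/

noncomputable section

-- `Summit.Schanuel.Schanuel.…` is the mandated summit/sub-problem namespace (single-conjunct summit), hence:
set_option linter.dupNamespace false

namespace Summit.Schanuel.Schanuel.Cruxes.ApproximationProperty.OrbitInterpolationDeterminant

open Literature.NumberTheory.Transcendental Literature.NumberTheory.Transcendental.Nesterenko
open Literature.NumberTheory.Transcendental.PhilipponMain (cons_one_ne_zero one_le_norm_cons_one
  ringKrullDim_quotient_eq_of_isUnmixedOfRank)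
open MvPolynomial Real Module
open Literature.RingTheory.MvPolynomial (idealDegree)
open scoped BigOperators

namespace CycleAP3DataProof

/-- **The clause-free `t = 3` descent with its construction data** (curried content of the
registered stub `stub_cycleAP3Data`): for every `ω ∈ ℂ³` a constant `c = 5000(c₂ + 1)(c_B + 1)`
(`c₂` the constant of the small prime space curve `smallPrimeCurve3_of small_prime_hypersurface`,
`c_B` that of the box principle modulo an ideal) such that for `c ≤ Δ ≤ Y` the surface `Q`, the
form `P`, the curve `𝔮`, the third form `T ∉ 𝔮` of degree `τ = a + b + ⌊Δ⌋ ≤ 5Δ` and the orbit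
`𝔭 ⊇ 𝔮 + (T)` selected by `small_prime_of_cut` (`m = 3`, `r = 2`, weights `(Δ, Y)`) form a
`CycleAP3Datum ω c Δ Y Q a P b 𝔮 T τ 𝔭`.
[cite: NesterenkoPhilippon2001, Ch. 3 Prop. 4.7, Prop. 4.11, Prop. 4.13 (pp. 39–41), §5 (p. 42); Ch. 4 §4 p. 61] -/
theorem main (ω : Fin 3 → ℂ) :
    ∃ c : ℝ, 1 ≤ c ∧ ∀ Δ Y : ℝ, c ≤ Δ → Δ ≤ Y →
      ∃ (Q : Rx 3) (a : ℕ) (P : Rx 3) (b : ℕ) (𝔮₂ : Ideal (Rx 3)) (T : Rx 3) (τ : ℕ)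
        (𝔭 : Ideal (Rx 3)), CycleAP3Datum ω c Δ Y Q a P b 𝔮₂ T τ 𝔭 := by
  classical
  unfold CycleAP3Datum
  obtain ⟨c₂, hc₂, hS⟩ := smallPrimeCurve3_of small_prime_hypersurface ω
  obtain ⟨cB, hcB, hBox⟩ := boxPrinciple_modIdeal 3 ω
  set ω₁ : Fin (3 + 1) → ℂ := Fin.cons 1 ω with hω₁def
  have hω₁ : ω₁ ≠ 0 := cons_one_ne_zero ω
  have hΘ : 1 ≤ ‖ω₁‖ := one_le_norm_cons_one ω
  -- the constant
  set c : ℝ := 5000 * (c₂ + 1) * (cB + 1) with hcdef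
  have hprod : 0 ≤ c₂ * cB := by positivity
  have hc5000 : 5000 ≤ c := by rw [hcdef]; nlinarith [hprod]
  have hcc₂ : 5000 * c₂ ≤ c := by rw [hcdef]; nlinarith [hprod]
  have hccB : 5000 * cB ≤ c := by rw [hcdef]; nlinarith [hprod]
  have hc₂c : c₂ ≤ c := by linarith
  have hc₂0 : 0 < c₂ := by linarith
  have hc1 : 1 ≤ c := by linarith
  have hc0 : 0 < c := by linarith
  refine ⟨c, hc1, fun Δ Y hΔ hY => ?_⟩
  have hΔ1 : 1 ≤ Δ := by linarith
  have hΔ0 : 0 < Δ := by linarith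
  have hY0 : 0 ≤ Y := by linarith
  have hYpos : 0 < Y := by linarith
  -- (SPC3): the small prime space curve `𝔮 ⊇ (Q, P)`
  obtain ⟨Q, a, P, b, 𝔮, hQ0, hQhom, ha1, haΔ, hQprime, hPhom, hb1, hbΔ, hPQ, hqprime, hqhom,
    hqunm, hQq, hPq, hdeg, hh, habs⟩ := hS Δ Y (by linarith) hY
  have hδ1n : 1 ≤ ideg 𝔮 2 :=
    Literature.Barriers.Schanuel.one_le_ideg_of_isPrime NesterenkoPhilippon2001_ch3_prop_4_4_holds
      (by norm_num) (by norm_num) hqprime hqhom hqunm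
  set δ : ℝ := (ideg 𝔮 2 : ℝ) with hδdef
  have hδ1 : 1 ≤ δ := by rw [hδdef]; exact_mod_cast hδ1n
  have hδ0 : 0 < δ := by linarith
  set h : ℝ := iheight 𝔮 2 with hhdef
  have hh0 : 0 ≤ h := height_nonneg _
  have hX0 : 0 ≤ Δ * h + Y * δ := by positivity
  set S₂ : ℝ := Δ / c₂ * (Δ * h + Y * δ) with hS₂def
  have hS₂0 : 0 ≤ S₂ := by rw [hS₂def]; positivity
  have hS₂X : S₂ ≤ Δ * (Δ * h + Y * δ) := by
    rw [hS₂def]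
    exact mul_le_mul_of_nonneg_right (div_le_self hΔ0.le hc₂) hX0
  -- the curve's bounds at the larger constant `c`
  have hhc : h ≤ c * Δ * Y :=
    hh.trans (mul_le_mul_of_nonneg_right (mul_le_mul_of_nonneg_right hc₂c hΔ0.le) hY0)
  have hS₂c : Δ / c * (Δ * h + Y * δ) ≤ S₂ := by
    rw [hS₂def]
    exact mul_le_mul_of_nonneg_right (div_le_div_of_nonneg_left hΔ0.le hc₂0 hc₂c) hX0
  have habsc : iabs 𝔮 2 ω₁ ≤ exp (-(Δ / c * (Δ * h + Y * δ))) :=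
    habs.trans (exp_le_exp.mpr (neg_le_neg hS₂c))
  -- the degree `g = ⌊Δ⌋` of the extra factor and `b₃ = a + b + g`
  obtain ⟨g, hgdef⟩ : ∃ g : ℕ, g = ⌊Δ⌋₊ := ⟨_, rfl⟩
  obtain ⟨-, hg10, hgΔ, hΔg⟩ := CycleAPITwo.floor_facts haΔ (by linarith : (10 : ℝ) ≤ Δ)
  rw [← hgdef] at hg10 hgΔ hΔg
  have hg0 : (0 : ℝ) < g := by exact_mod_cast (show 0 < g by omega)
  obtain ⟨b₃, hb₃def⟩ : ∃ b₃ : ℕ, b₃ = a + b + g := ⟨_, rfl⟩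
  have hab : a + b ≤ b₃ := by omega
  have hb₃g : b₃ - a - b = g := by omega
  have hb₃1 : 1 ≤ b₃ := by omega
  have hb₃pos : 0 < b₃ := hb₃1
  have hb₃R : (b₃ : ℝ) ≤ 4 * Δ := by rw [hb₃def]; push_cast; linarith
  have hb₃5 : (b₃ : ℝ) ≤ 5 * Δ := by linarith
  have hb₃0 : (0 : ℝ) ≤ b₃ := Nat.cast_nonneg _
  -- (H2): `M₃ = g deg 𝔮` free monomials of degree `b₃` modulo `𝔮`
  have hdim : ringKrullDim (Rx 3 ⧸ 𝔮) = (2 : ℕ) :=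
    ringKrullDim_quotient_eq_of_isUnmixedOfRank hqprime hqunm
  have hHilb := curveHilbert_lowerBound Q P a b hQ0 hQhom hPhom ha1 hb1 hQprime hPQ 𝔮 hqprime hqhom
    hQq hPq hdim b₃ hab
  obtain ⟨M₃, hM₃def⟩ : ∃ M : ℕ, M = g * ideg 𝔮 2 := ⟨_, rfl⟩
  rw [hb₃g, ← hM₃def] at hHilb
  have hM₃8 : 8 ≤ M₃ := by
    have : 10 * 1 ≤ g * ideg 𝔮 2 := Nat.mul_le_mul hg10 hδ1n
    omega
  have hM₃R : (M₃ : ℝ) = (g : ℝ) * δ := by rw [hM₃def, Nat.cast_mul, hδdef]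
  have hM₃8R : (8 : ℝ) ≤ M₃ := by exact_mod_cast hM₃8
  have hfin : finrank ℚ ↥(homogeneousSubmodule (Fin (3 + 1)) ℚ b₃ ⊓ 𝔮.restrictScalars ℚ) + M₃ ≤
      finrank ℚ ↥(homogeneousSubmodule (Fin (3 + 1)) ℚ b₃) := by
    have e : finrank ℚ ↥(homogeneousSubmodule (Fin (3 + 1)) ℚ b₃ ⊓ 𝔮.restrictScalars ℚ) =
        finrank ℚ ↥(idealDegree 𝔮 b₃) := by
      rw [idealDegree, inf_comm]
    rw [e]
    omega
  have hqI : ∀ f ∈ 𝔮, ∀ d : ℕ, homogeneousComponent d f ∈ 𝔮 := fun f hf d =>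
    MvPolynomial.homogeneousComponent_mem_of_mem hqhom hf d
  -- the adaptive height `h₃` and the box `N₃ = ⌊e^{h₃}⌋`
  set h₃ : ℝ := 4 * (S₂ + cB * (b₃ + 1)) / (g * δ) with hh₃def
  have hh₃0 : 0 ≤ h₃ := by rw [hh₃def]; positivity
  have hh₃eq : h₃ * (g * δ) = 4 * (S₂ + cB * (b₃ + 1)) := by
    rw [hh₃def]
    exact div_mul_cancel₀ _ (by positivity)
  obtain ⟨N₃, hN₃def⟩ : ∃ N : ℕ, N = ⌊exp h₃⌋₊ := ⟨_, rfl⟩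
  obtain ⟨hN1, hlogN, hlogN1⟩ := CycleAPITwo.box_facts hh₃0
  rw [← hN₃def] at hN1 hlogN hlogN1
  -- the third form `P₃ ∉ 𝔮`
  obtain ⟨P₃, hP₃q, hP₃hom, hP₃1, -, hhP₃, hP₃val⟩ := hBox 𝔮 b₃ N₃ M₃ hqI hN1 (by omega) hfin
  set hP : ℝ := height P₃ with hPdef
  have hP0 : 0 ≤ hP := height_nonneg _
  have hPh₃ : hP ≤ h₃ := hhP₃.trans hlogN
  have hK : hP * δ ≤ 8 * (Δ * h + Y * δ) + 40 * cB := by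
    have h1 : hP * δ ≤ h₃ * δ := mul_le_mul_of_nonneg_right hPh₃ hδ0.le
    have h2 := CycleAP3PrimeOfCurve.h3delta_le (cB := cB) (b₃ := (b₃ : ℝ)) hX0 hS₂X hcB hΔ1 hΔg
      hδ0 hb₃R
    rw [← hh₃def] at h2
    linarith
  -- smallness of the third form at `ω₁`
  have hnorm : normAt ω₁ P₃ ≤ exp (-S₂) := by
    have h1 : normAt ω₁ P₃ ≤ ‖aeval ω₁ P₃‖ := by
      rw [normAt]
      exact div_le_self (norm_nonneg _) (one_le_mul_of_one_le_of_one_le hP₃1 (one_le_pow₀ hΘ))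
    refine h1.trans (hP₃val.trans (exp_le_exp.mpr ?_))
    exact CycleAP3PrimeOfCurve.arith_box3 hS₂0 hcB hb₃0 hg0 hδ0 hM₃R hM₃8R hh₃eq hlogN1
  -- the cut
  set U₃ : ℝ := S₂ - (hP * δ + h * b₃ + 99 * δ * b₃) with hU₃def
  have hcut : hP * δ + h * b₃ + 99 * δ * b₃ + 54 * δ * b₃ ≤ S₂ / 2 :=
    CycleAP3PrimeOfCurve.arith_cut3 hc₂ (by linarith) (by linarith) hΔ hY hδ1 hh0 hb₃R hK hS₂def
  have hδb : 0 ≤ δ * b₃ := by positivity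
  have hU₃S : S₂ / 2 ≤ U₃ := by rw [hU₃def]; linarith
  have hE : height P₃ * (ideg 𝔮 2 : ℝ) + iheight 𝔮 2 * (b₃ : ℝ) +
      11 * ((3 : ℕ) : ℝ) ^ 2 * (ideg 𝔮 2 : ℝ) * (b₃ : ℝ) = hP * δ + h * b₃ + 99 * δ * b₃ := by
    rw [← hPdef, ← hhdef, ← hδdef]
    push_cast
    ring
  have hsmall : max (normAt ω₁ P₃) (iabs 𝔮 2 ω₁) *
      exp (height P₃ * (ideg 𝔮 2 : ℝ) + iheight 𝔮 2 * (b₃ : ℝ) +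
        11 * ((3 : ℕ) : ℝ) ^ 2 * (ideg 𝔮 2 : ℝ) * (b₃ : ℝ)) ≤ exp (-U₃) := by
    refine CycleAPITwo.max_mul_exp_le hnorm habs ?_ ?_ <;> linarith [hE, hU₃def]
  have hU₃54 : 2 * ((3 : ℕ) : ℝ) ^ 3 * ((ideg 𝔮 2 : ℝ) * (b₃ : ℝ)) ≤ U₃ := by
    rw [← hδdef]
    norm_num
    linarith
  obtain ⟨𝔭, h𝔭prime, h𝔭hom, h𝔭unm, hq𝔭, hP₃𝔭, h𝔭deg, h𝔭h, h𝔭abs⟩ :=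
    small_prime_of_cut 3 2 𝔮 P₃ b₃ ω₁ Δ Y U₃ le_rfl (by norm_num) hqprime hqhom hqunm hP₃hom hb₃1
      hP₃q hω₁ hΔ0.le hY0 (by linarith) hsmall hU₃54
  simp only [show (2 : ℕ) - 1 = 1 from rfl] at h𝔭unm h𝔭deg h𝔭h h𝔭abs
  rw [← hPdef, ← hhdef, ← hδdef] at h𝔭h h𝔭abs
  have h𝔭h0 : 0 ≤ iheight 𝔭 1 := height_nonneg _
  refine ⟨Q, a, P, b, 𝔮, P₃, b₃, 𝔭, hQ0, hQhom, ha1, haΔ, hQprime, hPhom, hb1, hbΔ, hPQ, hqprime,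
    hqhom, hqunm, hQq, hPq, hdeg, ?_, ?_, hP₃hom, hb₃1, hb₃5, hP₃q, h𝔭prime, h𝔭hom, h𝔭unm, hq𝔭,
    hP₃𝔭, h𝔭deg, ?_, ?_, ?_⟩
  · -- the curve's height at constant `c`
    rw [← hhdef]
    exact hhc
  · -- the curve's accuracy at rate `Δ / c`
    rw [← hhdef, ← hδdef]
    exact habsc
  · -- degree budget `deg 𝔭 ≤ deg 𝔮 · b₃ ≤ 8Δ³ ≤ (cΔ)³`
    have h1 : (ideg 𝔭 1 : ℝ) ≤ δ * b₃ := by rw [hδdef]; exact_mod_cast h𝔭deg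
    exact h1.trans (CycleAP3PrimeOfCurve.arith_deg3 (by linarith) hΔ0.le hdeg hb₃0 hb₃R)
  · -- height budget
    have h1 : iheight 𝔭 1 ≤ h * b₃ + hP * δ + 18 * δ * b₃ := by
      refine h𝔭h.trans (le_of_eq ?_)
      push_cast
      ring
    exact h1.trans
      (CycleAP3PrimeOfCurve.arith_height3 (by linarith) hcB hΔ1 hY hδ0.le hdeg hh0 hh hb₃R hK)
  · -- accuracy at the registered rate `1/c`
    have hrate := CycleAP3PrimeOfCurve.arith_rate3 (hP := hP) hc₂ (by linarith) (by linarith) hΔ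
      hY hδ1 hh0 hb₃R hK hS₂def hU₃S
    have hb₃posR : (0 : ℝ) < b₃ := by exact_mod_cast hb₃pos
    refine h𝔭abs.trans (CycleAP3PrimeOfCurve.exp_rate_le hc0 ?_ ?_ ?_)
    · have h1 : 0 ≤ Δ * (h * b₃ + hP * δ + (3 * (2 + 1) + 3 ^ 2) * δ * b₃) := by positivity
      have h2 : 0 < Y * (δ * b₃) := mul_pos hYpos (mul_pos hδ0 hb₃posR)
      push_cast
      linarith
    · exact add_nonneg (mul_nonneg hΔ0.le h𝔭h0) (mul_nonneg hY0 (Nat.cast_nonneg _))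
    · refine le_trans (le_of_eq ?_) hrate
      push_cast
      ring

end CycleAP3DataProof

/-- **Registered stub `stub_cycleAP3Data : CycleAP3Data`** (crux `stmt-Schanuel-6117`, line
`orbit-interpolation-determinant`, stub plan P1): the clause-free `t = 3` descent — Philippon's AP1
with `d' = 0` in `ℙ³`, prime output — WITH its construction data kept (surface, second cut, prime
curve with its bounds, third cut of degree `≤ 5Δ`, prime orbit with the Bézout bound and the
`CycleAPIAt 3` budgets), unconditionally: `CycleAP3DataProof.main`, i.e. the landed cuts 1–2
(`smallPrimeCurve3_of small_prime_hypersurface`), the curve Hilbert lower bound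
(`curveHilbert_lowerBound`), the box principle modulo the curve and `small_prime_of_cut`.
[cite: NesterenkoPhilippon2001, Ch. 3 Prop. 4.7, Prop. 4.11, Prop. 4.13 (pp. 39–41), §5 (p. 42); Ch. 4 §4 p. 61] -/
theorem stub_cycleAP3Data : CycleAP3Data := fun ω => CycleAP3DataProof.main ω

end Summit.Schanuel.Schanuel.Cruxes.ApproximationProperty.OrbitInterpolationDeterminant

end
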